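import Literature.Probability.Percolation.PortCountSq
import Literature.Probability.Percolation.PortChainFamily
import HarnessLib

/-!
# The port theory with the far connection restricted to window hubs

Topic `Probability/Percolation`.  Support file (proofs, no named fact) for step (C) of the proof of
Schramm–Smirnov's Prop. 4.1 (Ann. Probab. 39 (2011), §4).  `PortRuns.lean` proves owner constancy on
the open stretches of the traced loop (`hubConn_of_open_stretch'`) under the blanket hypothesis
`hfar`: for ANY two hub vertices cornering a common face, their far escapes are joined through far
hub vertices.  With several far components (enclosed components of the complement of the cut's
neighbourhood, as in the printed proof's `T̂`) the blanket form is false — two FAR sites of different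
components may corner a common face at a pinch of the fresh region — while the chord and pocket
lemmas of `PortOwners.lean` only ever use it for hub vertices OF THE WINDOW (endpoints of fresh
window edges).  This file re-derives the pocket-run lemma and the port theorem from the
window-restricted hypothesis `hfarW` (same statement with `c, c' ∈ Wv`); the proofs are those of
`PortRuns.lean` verbatim, the two calls to the far hypothesis receiving the window memberships at
hand.

* `TileData.FarW`, `farW_of_far`; `hubConn_piece1W`, `hubConn_piece2W`, `hubConn_of_pocketRunW`,
  **`hubConn_of_open_stretchW`**; the owner count with squares `exists_owners_sqW` (as
  `PortCountSq.exists_owners_sq`) and the family port chain `TileFamily.gst_of_samePortW`,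
  `TileFamily.portChainW_iff_mem_z2QuadConfig` (as `PortChainFamily`).

## References

* O. Schramm, S. Smirnov, *On the scaling limits of planar percolation*, Ann. Probab. 39 (2011)
  1768–1814, arXiv:1101.5820, §4, proof of Prop. 4.1 ("the beach is connected"). [SchrammSmirnov2011]
-/

noncomputable section

open Set Relation
open Literature.Probability.LatticeModels
open scoped Classical

namespace Literature.Probability.Percolation

namespace CellComplex

namespace TileData

variable {𝒯 : TileData} {d₀ : Site 2 × Fin 4}

/-- **The window-restricted far hypothesis**: for two hub vertices OF THE WINDOW cornering a common
face, the far endpoints of any examined open paths from them are joined through far hub vertices.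
(With several far components this is what the geometry provides: both hubs come from the same far
side of their collar.) [cite: SchrammSmirnov2011, §4, proof of Prop. 4.1 (each K_j has one long side on β)] -/
def FarW (𝒯 : TileData) : Prop :=
  ∀ c c' u₁ u₂ : Site 2, c ∈ 𝒯.O → c' ∈ 𝒯.O → c ∈ 𝒯.Wv → c' ∈ 𝒯.Wv → (∃ f, TouchesFace c f ∧ TouchesFace c' f) →
    u₁ ∉ 𝒯.Wv → u₂ ∉ 𝒯.Wv → ReflTransGen (fun a b => s(a, b) ∈ 𝒯.hubE) c u₁ →
    ReflTransGen (fun a b => s(a, b) ∈ 𝒯.hubE) c' u₂ → ReflTransGen (FarAdj 𝒯) u₂ u₁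

/-- The blanket far hypothesis of `PortRuns.lean` implies the window-restricted one. [folklore] -/
theorem farW_of_far
    (hfar : ∀ c c' u₁ u₂ : Site 2, c ∈ 𝒯.O → c' ∈ 𝒯.O → (∃ f, TouchesFace c f ∧ TouchesFace c' f) →
      u₁ ∉ 𝒯.Wv → u₂ ∉ 𝒯.Wv → ReflTransGen (fun a b => s(a, b) ∈ 𝒯.hubE) c u₁ →
      ReflTransGen (fun a b => s(a, b) ∈ 𝒯.hubE) c' u₂ → ReflTransGen (FarAdj 𝒯) u₂ u₁) : 𝒯.FarW :=
  fun c c' u₁ u₂ hc hc' _ _ hf hu₁ hu₂ h₁ h₂ => hfar c c' u₁ u₂ hc hc' hf hu₁ hu₂ h₁ h₂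

/-! ### The pieces under the window-restricted far hypothesis -/

section Pieces

variable (hT : 𝒯.Terminal)
  (hfar : 𝒯.FarW)
include hT hfar

/-- **Piece of length one** (the chord lemma along a side of a face of `U`). [folklore] -/
private theorem hubConn_piece1W {f : Site 2} {k : Fin 4} (hfU : φc f ∈ 𝒯.U) (hb : f + cornerOff k ∈ 𝒯.O)
    (hb' : f + cornerOff (k + 1) ∈ 𝒯.O) (hW : f + cornerOff k ∈ 𝒯.Wv) (hW' : f + cornerOff (k + 1) ∈ 𝒯.Wv)
    (hhub : dartEdge (f + cornerOff k) k ∉ 𝒯.hubE) (hcl : dartEdge (f + cornerOff k) k ∉ 𝒯.clE)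
    (hacc : dartEdge (f + cornerOff k) k ∉ 𝒯.acc) : 𝒯.HubConn (f + cornerOff k) (f + cornerOff (k + 1)) := by
  rw [add_cornerOff_succ] at hb' hW' ⊢
  refine 𝒯.hubConn_of_chord hT hb hb' hW hW' hhub hcl hacc (Or.inl (by rw [faceAt_add_cornerOff]; exact hfU)) ?_
  intro u₁ u₂ hu₁ hu₂ h₁ h₂
  refine hfar _ _ u₁ u₂ hb hb' hW hW' ⟨f, touchesFace_add_cornerOff f k, ?_⟩ hu₁ hu₂ h₁ h₂
  rw [← add_cornerOff_succ]; exact touchesFace_add_cornerOff f (k + 1)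

/-- **Piece of length two** (the pocket lemma along two sides of a face of `U`). [folklore] -/
private theorem hubConn_piece2W {f : Site 2} {k : Fin 4} (hfU : φc f ∈ 𝒯.U) (hb : f + cornerOff k ∈ 𝒯.O)
    (hb₁ : f + cornerOff (k + 1) ∉ 𝒯.O) (hσ₁ : σc (f + cornerOff (k + 1)) ∉ 𝒯.U) (hb₂ : f + cornerOff (k + 2) ∈ 𝒯.O)
    (hW : f + cornerOff k ∈ 𝒯.Wv) (hW₁ : f + cornerOff (k + 1) ∈ 𝒯.Wv) (hW₂ : f + cornerOff (k + 2) ∈ 𝒯.Wv)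
    (hhub : dartEdge (f + cornerOff k) k ∉ 𝒯.hubE) (hcl : dartEdge (f + cornerOff k) k ∉ 𝒯.clE)
    (hacc : dartEdge (f + cornerOff k) k ∉ 𝒯.acc)
    (hhub' : dartEdge (f + cornerOff (k + 1)) (k + 1) ∉ 𝒯.hubE) (hcl' : dartEdge (f + cornerOff (k + 1)) (k + 1) ∉ 𝒯.clE)
    (hacc' : dartEdge (f + cornerOff (k + 1)) (k + 1) ∉ 𝒯.acc) :
    𝒯.HubConn (f + cornerOff k) (f + cornerOff (k + 2)) := by
  have e1 : f + cornerOff (k + 1) = f + cornerOff k + cornerUnit k := add_cornerOff_succ f k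
  have e2 : f + cornerOff (k + 2) = f + cornerOff k + cornerUnit k + cornerUnit (k + 1) := by
    rw [← e1, ← fin4_add_one_add_one, add_cornerOff_succ f (k + 1)]
  have hnacc : ∀ e ∈ 𝒯.acc, f + cornerOff (k + 1) ∉ e := by
    intro e he hmem
    exact hσ₁ ((σc_mem_U_iff 𝒯).2 ⟨hb₁, e, he, hmem⟩)
  have hne : f + cornerOff k ≠ f + cornerOff (k + 2) := by
    intro h
    have := cornerOff_injective (add_left_cancel h)
    exact absurd this (by fin_cases k <;> decide)
  rw [e1] at hb₁ hW₁ hhub' hcl' hacc' hnacc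
  rw [e2] at hb₂ hW₂ hne ⊢
  refine 𝒯.hubConn_of_pocket hT hb hb₁ hb₂ hne hW hW₁ hW₂ hnacc hhub hcl hacc hhub' hcl' hacc'
    (Or.inl (by rw [faceAt_add_cornerOff]; exact hfU)) ?_
  intro u₁ u₂ hu₁ hu₂ h₁ h₂
  refine hfar _ _ u₁ u₂ hb hb₂ hW hW₂ ⟨f, touchesFace_add_cornerOff f k, ?_⟩ hu₁ hu₂ h₁ h₂
  rw [← e2]; exact touchesFace_add_cornerOff f (k + 2)

end Pieces

/-! ### Pocket runs and the port theorem -/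

section Run

variable (h₀ : IsBd 𝒯.U d₀) (hT : 𝒯.Terminal)
  (hfar : 𝒯.FarW)
include h₀ hT hfar

/-- **The pocket run lemma.**  If the sides `i+1, …, i+n` (`n ≥ 1`) of the loop have pocket
out-cells and the sides `i` and `i+n+1` are hub contacts, then the vertices attached to these two
hub cells are hub-connected. [cite: SchrammSmirnov2011, §4, proof of Prop. 4.1 ("the beach is connected")] -/
private theorem hubConn_of_pocketRunW {i n : ℕ} (hn : 1 ≤ n) (hpocket : ∀ t, t < n → 𝒯.IsPocketCell (𝒯.outCell d₀ (i + 1 + t)))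
    (hi : 𝒯.hubContact d₀ i) (hi' : 𝒯.hubContact d₀ (i + n + 1)) {v v' : Site 2}
    (hv : v ∈ 𝒯.att (𝒯.outCell d₀ i)) (hv' : v' ∈ 𝒯.att (𝒯.outCell d₀ (i + n + 1))) : 𝒯.HubConn v v' := by
  -- the face and the position of the first pocket side
  have hp0 : 𝒯.IsPocketCell (faceAt (vert 𝒯.U d₀ (i + 1)) (dirAt 𝒯.U d₀ (i + 1) + 3)) := by
    simpa [TileData.outCell] using hpocket 0 hn
  obtain ⟨f, m₀, hF0⟩ := exists_fSide_of_pocket h₀ hp0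
  -- the following sides of the run are the following sides of `f` (unrolled: the run is short)
  have hF1 : 1 < n → σc (f + cornerOff (m₀ + 1)) ∉ 𝒯.U ∧ FSide 𝒯.U d₀ (i + 1 + 1) f (m₀ + 1) := fun h1 =>
    FSide.succ_of_pocket hF0 hp0 (by simpa [TileData.outCell, add_assoc] using hpocket 1 h1)
  have hF2 : 2 < n → σc (f + cornerOff (m₀ + 1 + 1)) ∉ 𝒯.U ∧ FSide 𝒯.U d₀ (i + 1 + 1 + 1) f (m₀ + 1 + 1) := fun h2 =>
    FSide.succ_of_pocket (hF1 (by omega)).2 (by simpa [TileData.outCell, add_assoc] using hpocket 1 (by omega))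
      (by simpa [TileData.outCell, add_assoc] using hpocket 2 h2)
  have hF3 : 3 < n → σc (f + cornerOff (m₀ + 1 + 1 + 1)) ∉ 𝒯.U ∧ FSide 𝒯.U d₀ (i + 1 + 1 + 1 + 1) f (m₀ + 1 + 1 + 1) :=
    fun h3 => FSide.succ_of_pocket (hF2 (by omega)).2 (by simpa [TileData.outCell, add_assoc] using hpocket 2 (by omega))
      (by simpa [TileData.outCell, add_assoc] using hpocket 3 h3)
  -- the edges of the run are fresh window edges
  have hE0 := pocket_edge hF0 hp0
  have hE1 : 1 < n → _ := fun h1 => pocket_edge (hF1 h1).2 (by simpa [TileData.outCell, add_assoc] using hpocket 1 h1)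
  have hE2 : 2 < n → _ := fun h2 => pocket_edge (hF2 h2).2 (by simpa [TileData.outCell, add_assoc] using hpocket 2 h2)
  have hE3 : 3 < n → _ := fun h3 => pocket_edge (hF3 h3).2 (by simpa [TileData.outCell, add_assoc] using hpocket 3 h3)
  -- the face is in `U`
  have hfU : φc f ∈ 𝒯.U := by
    have := (isBd_bdOrbit h₀ (i + 1)).1
    rwa [show (bdOrbit 𝒯.U d₀ (i + 1)).1 = vert 𝒯.U d₀ (i + 1) from rfl,
      show (bdOrbit 𝒯.U d₀ (i + 1)).2 = dirAt 𝒯.U d₀ (i + 1) from rfl, hF0.inCell] at this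
  obtain ⟨-, eacc, heacc, hfe⟩ := (φc_mem_U_iff 𝒯).1 hfU
  obtain ⟨m', rfl⟩ := (isFaceOf_iff_exists_faceSide (𝒯.acc_edge eacc heacc)).1 hfe
  obtain ⟨t, rfl⟩ := fin4_exists_add m₀ m'
  -- the run has length at most three: otherwise all four sides of `f` would be inaccessible
  have hn3 : n ≤ 3 := by
    by_contra hn4
    rcases (show t = 0 ∨ t = 1 ∨ t = 2 ∨ t = 3 by fin_cases t <;> simp) with rfl | rfl | rfl | rfl
    · exact hE0.2.2.1 (by simpa [faceSide] using heacc)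
    · exact (hE1 (by omega)).2.2.1 heacc
    · rw [← fin4_add_one_add_one] at heacc; exact (hE2 (by omega)).2.2.1 heacc
    · rw [← fin4_one_one_one] at heacc; exact (hE3 (by omega)).2.2.1 heacc
  -- the pieces
  have P1 : ∀ k : Fin 4, f + cornerOff k ∈ 𝒯.O → f + cornerOff (k + 1) ∈ 𝒯.O →
      (dartEdge (f + cornerOff k) k ∉ 𝒯.hubE ∧ dartEdge (f + cornerOff k) k ∉ 𝒯.clE ∧ dartEdge (f + cornerOff k) k ∉ 𝒯.acc ∧
        f + cornerOff k ∈ 𝒯.Wv ∧ f + cornerOff (k + 1) ∈ 𝒯.Wv) → 𝒯.HubConn (f + cornerOff k) (f + cornerOff (k + 1)) :=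
    fun k hb hb' ⟨hhub, hcl, hacc, hW, hW'⟩ => hubConn_piece1W hT hfar hfU hb hb' hW hW' hhub hcl hacc
  have P2 : ∀ k : Fin 4, f + cornerOff k ∈ 𝒯.O → f + cornerOff (k + 1) ∉ 𝒯.O → σc (f + cornerOff (k + 1)) ∉ 𝒯.U →
      f + cornerOff (k + 1 + 1) ∈ 𝒯.O →
      (dartEdge (f + cornerOff k) k ∉ 𝒯.hubE ∧ dartEdge (f + cornerOff k) k ∉ 𝒯.clE ∧ dartEdge (f + cornerOff k) k ∉ 𝒯.acc ∧
        f + cornerOff k ∈ 𝒯.Wv ∧ f + cornerOff (k + 1) ∈ 𝒯.Wv) →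
      (dartEdge (f + cornerOff (k + 1)) (k + 1) ∉ 𝒯.hubE ∧ dartEdge (f + cornerOff (k + 1)) (k + 1) ∉ 𝒯.clE ∧
        dartEdge (f + cornerOff (k + 1)) (k + 1) ∉ 𝒯.acc ∧ f + cornerOff (k + 1) ∈ 𝒯.Wv ∧ f + cornerOff (k + 1 + 1) ∈ 𝒯.Wv) →
      𝒯.HubConn (f + cornerOff k) (f + cornerOff (k + 1 + 1)) := by
    rintro k hb hb₁ hσ₁ hb₂ ⟨hhub, hcl, hacc, hW, hW'⟩ ⟨hhub', hcl', hacc', -, hW''⟩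
    rw [fin4_add_one_add_one] at hb₂ hW'' ⊢
    exact hubConn_piece2W hT hfar hfU hb hb₁ hσ₁ hb₂ hW hW' hW'' hhub hcl hacc hhub' hcl' hacc'
  -- entry corner
  obtain ⟨hb₀, hventry⟩ : f + cornerOff m₀ ∈ 𝒯.O ∧ 𝒯.HubConn v (f + cornerOff m₀) :=
    FSide.hubConn_near hF0 hi (𝒯.outCell_corner d₀ i).1 hv
  refine hventry.trans ?_
  -- case analysis on `n ∈ {1, 2, 3}`
  rcases (by omega : n = 1 ∨ n = 2 ∨ n = 3) with rfl | rfl | rfl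
  · -- one pocket side: exit at `f + cornerOff (m₀ + 1)`
    obtain ⟨hb₁, hvexit⟩ := FSide.hubConn_far hF0 hi' ⟨_, rfl⟩ hv'
    exact (P1 m₀ hb₀ hb₁ hE0).trans hvexit.symm
  · obtain ⟨hb₂, hvexit⟩ := FSide.hubConn_far (hF1 (by omega)).2 hi' ⟨_, rfl⟩ hv'
    refine HubConn.trans ?_ hvexit.symm
    by_cases hb₁ : f + cornerOff (m₀ + 1) ∈ 𝒯.O
    · exact (P1 m₀ hb₀ hb₁ hE0).trans (P1 (m₀ + 1) hb₁ hb₂ (hE1 (by omega)))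
    · exact P2 m₀ hb₀ hb₁ (hF1 (by omega)).1 hb₂ hE0 (hE1 (by omega))
  · obtain ⟨hb₃, hvexit⟩ := FSide.hubConn_far (hF2 (by omega)).2 hi' ⟨_, rfl⟩ hv'
    refine HubConn.trans ?_ hvexit.symm
    by_cases hb₁ : f + cornerOff (m₀ + 1) ∈ 𝒯.O <;> by_cases hb₂ : f + cornerOff (m₀ + 1 + 1) ∈ 𝒯.O
    · -- O, O: three chords
      exact ((P1 m₀ hb₀ hb₁ hE0).trans (P1 (m₀ + 1) hb₁ hb₂ (hE1 (by omega)))).trans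
        (P1 (m₀ + 1 + 1) hb₂ hb₃ (hE2 (by omega)))
    · -- O, ¬O: chord then pocket
      exact (P1 m₀ hb₀ hb₁ hE0).trans (P2 (m₀ + 1) hb₁ hb₂ (hF2 (by omega)).1 hb₃ (hE1 (by omega)) (hE2 (by omega)))
    · -- ¬O, O: pocket then chord
      exact (P2 m₀ hb₀ hb₁ (hF1 (by omega)).1 hb₂ hE0 (hE1 (by omega))).trans (P1 (m₀ + 1 + 1) hb₂ hb₃ (hE2 (by omega)))
    · -- ¬O, ¬O: the accessible side of `f` would join two hub vertices
      exfalso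
      rcases (show t = 0 ∨ t = 1 ∨ t = 2 ∨ t = 3 by fin_cases t <;> simp) with rfl | rfl | rfl | rfl
      · exact hE0.2.2.1 (by simpa [faceSide] using heacc)
      · exact (hE1 (by omega)).2.2.1 heacc
      · rw [← fin4_add_one_add_one] at heacc; exact (hE2 (by omega)).2.2.1 heacc
      · -- the fourth side: endpoints `f + cornerOff (m₀+3)` and `f + cornerOff m₀`, both hub vertices
        obtain ⟨w, hw, hwO⟩ := 𝒯.acc_nonO _ heacc
        rw [faceSide] at hw
        rcases mem_dartEdge_iff.1 hw with rfl | rfl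
        · rw [← fin4_one_one_one] at hwO; exact hwO hb₃
        · rw [← add_cornerOff_succ, fin4_add_three_add_one] at hwO
          exact hwO hb₀

/-- **The port theorem, hub-or-pocket form, window-restricted far hypothesis.**
[cite: SchrammSmirnov2011, §4, proof of Prop. 4.1 ("the beach is connected")] -/
private theorem hubConn_of_open_stretchW_aux {i i' : ℕ} (hii' : i ≤ i')
    (hopen : ∀ l, i ≤ l → l ≤ i' → 𝒯.hubContact d₀ l ∨ 𝒯.IsPocketCell (𝒯.outCell d₀ l))
    (hi : 𝒯.hubContact d₀ i) (hi' : 𝒯.hubContact d₀ i') {v v' : Site 2}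
    (hv : v ∈ 𝒯.att (𝒯.outCell d₀ i)) (hv' : v' ∈ 𝒯.att (𝒯.outCell d₀ i')) : 𝒯.HubConn v v' := by
  -- strong induction on the length of the stretch
  induction hd : i' - i using Nat.strong_induction_on generalizing i v with
  | _ d ih =>
    rcases hii'.eq_or_lt with rfl | hlt
    · exact 𝒯.hubConn_of_run le_rfl (fun l h1 h2 => by rw [le_antisymm h2 h1]; exact hi) hv hv'
    · rcases hopen (i + 1) (by omega) (by omega) with hhub | hpk
      · obtain ⟨w, hw⟩ := 𝒯.att_nonempty hhub
        refine (𝒯.hubConn_of_consecutive hi hhub hv hw).trans ?_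
        exact ih (i' - (i + 1)) (by omega) (by omega) (fun l h1 h2 => hopen l (by omega) h2) hhub hw rfl
      · classical
        have hex : ∃ q, i < q ∧ 𝒯.hubContact d₀ q := ⟨i', hlt, hi'⟩
        set q := Nat.find hex with hq
        obtain ⟨hiq, hqhub⟩ : i < q ∧ 𝒯.hubContact d₀ q := Nat.find_spec hex
        have hqi' : q ≤ i' := Nat.find_min' hex ⟨hlt, hi'⟩
        have hmin : ∀ l, i < l → l < q → ¬ 𝒯.hubContact d₀ l := fun l h1 h2 h3 =>
          Nat.find_min hex (by rwa [← hq]) ⟨h1, h3⟩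
        have hq2 : i + 2 ≤ q := by
          by_contra h
          have : q = i + 1 := by omega
          exact not_isHubCell_of_isPocketCell hpk (this ▸ hqhub)
        set n := q - i - 1 with hn
        have hpocket : ∀ t, t < n → 𝒯.IsPocketCell (𝒯.outCell d₀ (i + 1 + t)) := by
          intro t ht
          rcases hopen (i + 1 + t) (by omega) (by omega) with h | h
          · exact absurd h (hmin _ (by omega) (by omega))
          · exact h
        obtain ⟨w, hw⟩ := 𝒯.att_nonempty hqhub
        have hqeq : i + n + 1 = q := by omega
        have hrun := hubConn_of_pocketRunW h₀ hT hfar (i := i) (n := n) (by omega) hpocket hi (hqeq ▸ hqhub) hv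
          (v' := w) (by rw [hqeq]; exact hw)
        refine hrun.trans ?_
        exact ih (i' - q) (by omega) hqi' (fun l h1 h2 => hopen l (by omega) h2) hqhub hw rfl

/-- **The port theorem under the window-restricted far hypothesis**: on a stretch of the traced loop all
of whose sides are hub contacts or pocket contacts, the vertices attached to ANY two hub contacts (in
either order) are joined by examined open edges — a port has one owner hub.
[cite: SchrammSmirnov2011, §4, proof of Prop. 4.1 ("the beach is connected")] -/
theorem hubConn_of_open_stretchW {i i' : ℕ}
    (hopen : ∀ l, min i i' ≤ l → l ≤ max i i' → 𝒯.hubContact d₀ l ∨ 𝒯.IsPocketCell (𝒯.outCell d₀ l))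
    (hi : 𝒯.hubContact d₀ i) (hi' : 𝒯.hubContact d₀ i') {v v' : Site 2}
    (hv : v ∈ 𝒯.att (𝒯.outCell d₀ i)) (hv' : v' ∈ 𝒯.att (𝒯.outCell d₀ i')) : 𝒯.HubConn v v' := by
  rcases le_total i i' with h | h
  · exact hubConn_of_open_stretchW_aux h₀ hT hfar h (fun l h1 h2 => hopen l (by omega) (by omega)) hi hi' hv hv'
  · exact (hubConn_of_open_stretchW_aux h₀ hT hfar h (fun l h1 h2 => hopen l (by omega) (by omega)) hi' hi hv' hv).symm

end Run

/-! ### The owner count with squares -/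

section OwnersSq

variable {SQ : Set (Site 2)} (hSQW : ∀ q ∈ SQ, q ∉ 𝒯.Wv) (hSQO : ∀ q ∈ SQ, q ∉ 𝒯.O)
  (hT : 𝒯.Terminal) (hfarO : ∀ u, u ∉ 𝒯.Wv → u ∈ 𝒯.O ∨ u ∈ SQ)
  (hX : ∀ e ∈ (zdGraph 2).edgeSet, (∃ v ∈ e, v ∈ 𝒯.Wv) → (∃ u ∈ e, u ∉ 𝒯.Wv) →
    e ∈ 𝒯.hubE ∨ e ∈ 𝒯.clE ∨ ∃ q ∈ e, q ∈ SQ)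
  (h₀ : IsBd 𝒯.U d₀) (hdisj : ∀ e ∈ 𝒯.hubE, e ∉ 𝒯.clE)
include hSQW hSQO hT hfarO hX h₀ hdisj

/-- **The owners of the hub contacts are few (with squares), window-restricted far hypothesis**
(`PortRunsW.hubConn_of_open_stretchW'`).  There is a set `R` of at most
`max 1 (2 · #landings + #sqSides)` hub vertices such that every vertex attached to a hub contact of the
loop is joined by examined open edges to a vertex of `R`.
[cite: SchrammSmirnov2011, §4, proof of Prop. 4.1 ("on ¬S the number of bays is bounded")] -/
theorem exists_owners_sqW (hfarW : 𝒯.FarW) : ∃ R : Finset (Site 2),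
    R.card ≤ max 1 (2 * (𝒯.landings).card + (𝒯.sqSides d₀ SQ h₀).card) ∧
    ∀ i, 𝒯.hubContact d₀ i → ∀ v ∈ 𝒯.att (𝒯.outCell d₀ i), ∃ r ∈ R, 𝒯.HubConn v r := by
  classical
  have hP0 : 0 < period h₀ := period_pos h₀
  have hout_per : ∀ i q, 𝒯.outCell d₀ (i + q * (period h₀)) = 𝒯.outCell d₀ i := outCell_add_mul_period h₀
  have hhub_per : ∀ i q, 𝒯.hubContact d₀ (i + q * (period h₀)) ↔ 𝒯.hubContact d₀ i := fun i q => by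
    simp only [TileData.hubContact, hout_per]
  have hopen_per : ∀ i q, 𝒯.IsOpenSide d₀ (i + q * (period h₀)) ↔ 𝒯.IsOpenSide d₀ i := fun i q => by
    simp only [IsOpenSide, TileData.hubContact, hout_per]
  have hcl_per : ∀ i q, 𝒯.IsClosedCell' SQ (𝒯.outCell d₀ (i + q * (period h₀))) ↔ 𝒯.IsClosedCell' SQ (𝒯.outCell d₀ i) :=
    fun i q => by rw [hout_per]
  by_cases hall : ∀ i, i < (period h₀) → 𝒯.IsOpenSide d₀ i
  · have hopen : ∀ i, 𝒯.IsOpenSide d₀ i := by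
      intro i
      have := hall (i % (period h₀)) (Nat.mod_lt _ hP0)
      rwa [← hopen_per (i % (period h₀)) (i / (period h₀)), Nat.mod_add_div'] at this
    by_cases hex : ∃ i, 𝒯.hubContact d₀ i
    · obtain ⟨i₁, hi₁⟩ := hex
      obtain ⟨w, hw⟩ := 𝒯.att_nonempty hi₁
      refine ⟨{w}, by simp, fun i hi v hv => ⟨w, Finset.mem_singleton_self _, ?_⟩⟩
      rcases le_total i i₁ with h | h
      · exact hubConn_of_open_stretchW_aux h₀ hT hfarW h (fun l _ _ => hopen l) hi hi₁ hv hw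
      · exact (hubConn_of_open_stretchW_aux h₀ hT hfarW h (fun l _ _ => hopen l) hi₁ hi hw hv).symm
    · push Not at hex
      exact ⟨∅, by simp, fun i hi => absurd hi (hex i)⟩
  · push Not at hall
    obtain ⟨i₁, hi₁P, hi₁⟩ := hall
    have hcl₁ : 𝒯.IsClosedCell' SQ (𝒯.outCell d₀ i₁) :=
      (isOpenSide_or_isClosedCell' hT hfarO hX h₀ i₁).resolve_left hi₁
    let good : ℕ → Prop := fun t => ∃ n, t < n ∧ 𝒯.hubContact d₀ n ∧ ∀ j, t < j → j ≤ n → 𝒯.IsOpenSide d₀ j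
    let rep : ℕ → Site 2 := fun t =>
      if h : good t then (𝒯.att_nonempty (Nat.find_spec h).2.1).choose else 0
    refine ⟨(𝒯.transitions' d₀ SQ h₀).image rep, ?_, ?_⟩
    · exact (Finset.card_image_le.trans (card_transitions'_le h₀)).trans (le_max_right _ _)
    · intro i hi v hv
      obtain ⟨r, k, hrP, hik⟩ : ∃ r k, r < period h₀ ∧ i = r + k * period h₀ :=
        ⟨i % period h₀, i / period h₀, Nat.mod_lt _ hP0, (Nat.mod_add_div' i _).symm⟩
      obtain ⟨n₀, hn₀⟩ : ∃ n₀, n₀ = r + 1 * period h₀ := ⟨_, rfl⟩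
      have hi' : 𝒯.hubContact d₀ n₀ := by rw [hn₀, hhub_per, ← hhub_per r k, ← hik]; exact hi
      have hv' : v ∈ 𝒯.att (𝒯.outCell d₀ n₀) := by rw [hn₀, hout_per, ← hout_per r k, ← hik]; exact hv
      have hexc : ∃ c, c < n₀ ∧ n₀ ≤ c + period h₀ ∧ 𝒯.IsClosedCell' SQ (𝒯.outCell d₀ c) := by
        by_cases hlt : r ≤ i₁
        · exact ⟨i₁, by omega, by omega, hcl₁⟩
        · refine ⟨i₁ + 1 * period h₀, by omega, by omega, ?_⟩
          rw [hcl_per]; exact hcl₁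
      set c := Nat.findGreatest (fun c => 𝒯.IsClosedCell' SQ (𝒯.outCell d₀ c)) (n₀ - 1) with hc
      obtain ⟨c₁, hc₁lt, hc₁le, hc₁cl⟩ := hexc
      have hcle : c ≤ n₀ - 1 := Nat.findGreatest_le _
      have hc₁c : c₁ ≤ c := Nat.le_findGreatest (by omega) hc₁cl
      have hccl : 𝒯.IsClosedCell' SQ (𝒯.outCell d₀ c) :=
        Nat.findGreatest_spec (P := fun c => 𝒯.IsClosedCell' SQ (𝒯.outCell d₀ c)) (by omega) hc₁cl
      have hopen_after : ∀ j, c < j → j ≤ n₀ → 𝒯.IsOpenSide d₀ j := by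
        intro j hcj hjn
        rcases (isOpenSide_or_isClosedCell' hT hfarO hX h₀ j) with h | h
        · exact h
        · exfalso
          rcases Nat.lt_or_ge j n₀ with hjn' | hjn'
          · have := Nat.le_findGreatest (P := fun c => 𝒯.IsClosedCell' SQ (𝒯.outCell d₀ c)) (n := n₀ - 1) (by omega) h
            rw [← hc] at this
            omega
          · have : j = n₀ := le_antisymm hjn hjn'
            rw [this] at h
            exact (not_open_of_isClosedCell' hSQW hSQO hdisj h).1 hi'
      obtain ⟨t, q, htP, hcq⟩ : ∃ t q, t < period h₀ ∧ c = t + q * period h₀ :=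
        ⟨c % period h₀, c / period h₀, Nat.mod_lt _ hP0, (Nat.mod_add_div' c _).symm⟩
      have htT : t ∈ 𝒯.transitions' d₀ SQ h₀ := by
        refine Finset.mem_filter.2 ⟨Finset.mem_range.2 htP, ?_, ?_⟩
        · rw [← hcl_per t q, ← hcq]; exact hccl
        · rw [← hopen_per (t + 1) q, show t + 1 + q * period h₀ = c + 1 by rw [hcq]; ring]
          exact hopen_after (c + 1) (by omega) (by omega)
      obtain ⟨m, hmn⟩ : ∃ m, m + q * period h₀ = n₀ := ⟨n₀ - q * period h₀, by omega⟩
      have hm_hub : 𝒯.hubContact d₀ m := by rw [← hhub_per m q, hmn]; exact hi'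
      have hm_att : v ∈ 𝒯.att (𝒯.outCell d₀ m) := by rw [← hout_per m q, hmn]; exact hv'
      have hm_open : ∀ j, t < j → j ≤ m → 𝒯.IsOpenSide d₀ j := by
        intro j h1 h2
        rw [← hopen_per j q]
        exact hopen_after _ (by omega) (by omega)
      have hgood : good t := ⟨m, by omega, hm_hub, hm_open⟩
      refine ⟨rep t, Finset.mem_image.2 ⟨t, htT, rfl⟩, ?_⟩
      have hrep : rep t = (𝒯.att_nonempty (Nat.find_spec hgood).2.1).choose := by
        simp only [rep, dif_pos hgood]
      obtain ⟨htn₁, hn₁hub, hn₁open⟩ := Nat.find_spec hgood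
      have hn₁m : Nat.find hgood ≤ m := Nat.find_min' hgood ⟨by omega, hm_hub, hm_open⟩
      have hw : rep t ∈ 𝒯.att (𝒯.outCell d₀ (Nat.find hgood)) := by
        rw [hrep]; exact (𝒯.att_nonempty (Nat.find_spec hgood).2.1).choose_spec
      exact (hubConn_of_open_stretchW_aux h₀ hT hfarW hn₁m (fun l h1 h2 => hm_open l (by omega) h2) hn₁hub hm_hub hw hm_att).symm


end OwnersSq

end TileData

/-! ### The family port chain -/

namespace TileFamily

open TileData QuadCrossing

variable {ι : Type*} {𝔉 : TileFamily ι}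

section PortsW

variable {D : Set ℂ} {δ : ℝ} {Q : Quad D} {η : BondConfig (Site 2)} {d₀ : ι → Site 2 × Fin 4}

variable (h₀ : ∀ i, IsBd (𝔉.𝒯 i).U (d₀ i)) (hT : ∀ i, (𝔉.𝒯 i).Terminal)
  (hfar : ∀ i, (𝔉.𝒯 i).FarW)
  (hhubη : ∀ e ∈ 𝔉.hubE, e ∈ η)
  (hhubQ : ∀ (y : Site 2) (m : Fin 4), dartEdge y m ∈ 𝔉.hubE →
    segment ℝ (meshPoint δ y) (meshPoint δ (y + cornerUnit m)) ⊆ Q.carrier)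
include h₀ hT hfar hhubη hhubQ

/-- **Hub contacts of one port are revealed-connected**, window-restricted far hypothesis.
[cite: SchrammSmirnov2011, §4, proof of Prop. 4.1 (one vertex of G per open bay)] -/
private theorem gst_of_samePortW {i : ι} {a b : ℕ} (ha : (𝔉.𝒯 i).hubContact (d₀ i) a) (hb : (𝔉.𝒯 i).hubContact (d₀ i) b)
    (hab : (𝔉.𝒯 i).SamePort (d₀ i) (h₀ i) a b) : 𝔉.Gst d₀ Q δ η (i, a) (i, b) := by
  obtain ⟨p, q, lo, hi', h1, h2, h3, h4, hopen⟩ := hab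
  have hper : ∀ n r, (𝔉.𝒯 i).outCell (d₀ i) (n + r * period (h₀ i)) = (𝔉.𝒯 i).outCell (d₀ i) n :=
    outCell_add_mul_period (h₀ i)
  have ha' : (𝔉.𝒯 i).hubContact (d₀ i) (a + p * period (h₀ i)) := by rwa [TileData.hubContact, hper]
  have hb' : (𝔉.𝒯 i).hubContact (d₀ i) (b + q * period (h₀ i)) := by rwa [TileData.hubContact, hper]
  obtain ⟨v, hv⟩ := (𝔉.𝒯 i).att_nonempty ha'
  obtain ⟨w, hw⟩ := (𝔉.𝒯 i).att_nonempty hb'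
  have hconn : (𝔉.𝒯 i).HubConn v w := by
    rcases le_total (a + p * period (h₀ i)) (b + q * period (h₀ i)) with hle | hle
    · exact hubConn_of_open_stretchW_aux (h₀ i) (hT i) (hfar i) hle (fun l hl1 hl2 => hopen l (by omega) (by omega)) ha' hb' hv hw
    · exact (hubConn_of_open_stretchW_aux (h₀ i) (hT i) (hfar i) hle (fun l hl1 hl2 => hopen l (by omega) (by omega)) hb' ha' hw hv).symm
  have hvW : v ∈ 𝔉.Wv := by rw [← 𝔉.Wv_eq i]; exact att_mem_Wv (hT i) (h₀ i) ha' hv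
  have hvO : v ∈ 𝔉.O := by rw [← 𝔉.O_eq i]; exact hv.1
  haveI : Nonempty ι := ⟨i⟩
  have hhubQ' : ∀ (y : Site 2) (m : Fin 4), dartEdge y m ∈ (𝔉.𝒯 i).hubE →
      segment ℝ (meshPoint δ y) (meshPoint δ (y + cornerUnit m)) ⊆ Q.carrier := by
    rw [𝔉.hubE_eq]; exact hhubQ
  have hvpt : meshPoint δ v ∈ openEdgeUnion δ (η \ 𝔉.accU) ∧ meshPoint δ v ∈ Q.carrier :=
    ⟨meshPoint_mem_openEdgeUnion_of_hub hhubη hvO hvW, meshPoint_mem_carrier_of_hub hhubQ' hv.1 (by rw [𝔉.Wv_eq]; exact hvW)⟩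
  refine ⟨ha, hb, v, ?_, w, ?_, revPt_of_hubConn hhubη hhubQ hconn hvpt⟩
  · show v ∈ (𝔉.𝒯 i).att ((𝔉.𝒯 i).outCell (d₀ i) a)
    rwa [hper] at hv
  · show w ∈ (𝔉.𝒯 i).att ((𝔉.𝒯 i).outCell (d₀ i) b)
    rwa [hper] at hw

variable (hδ : 0 < δ) (hcons : ∀ e ∈ 𝔉.clE, e ∉ η)
  (hX : ∀ e ∈ (zdGraph 2).edgeSet, (∃ v ∈ e, v ∈ 𝔉.Wv) → (∃ u ∈ e, u ∉ 𝔉.Wv) → e ∈ 𝔉.hubE ∨ e ∈ 𝔉.clE)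
  (hside0 : Disjoint (Q.side 0) (openEdgeUnion δ (η ∩ 𝔉.accU))) (hside2 : Disjoint (Q.side 2) (openEdgeUnion δ (η ∩ 𝔉.accU)))
  (hacc : ∀ u v : Site 2, AccAdj η 𝔉.accU u v → segment ℝ (meshPoint δ u) (meshPoint δ v) ⊆ Q.carrier)
include hδ hcons hX hside0 hside2 hacc

/-- **The crossing event of the cut quad as a function of the explored data and the port-level bits
of all the accessible components**, window-restricted far hypothesis (`PortRunsW`).
[cite: SchrammSmirnov2011, §4, proof of Prop. 4.1 ("ω̃ ∈ ⊞_{Q₀} iff there is a path from ∂₀Q₀ to ∂₂Q₀ in G ∪ G*")] -/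
theorem portChainW_iff_mem_z2QuadConfig :
    (∃ z₀ ∈ Q.side 0 ∩ openEdgeUnion δ η, ∃ z₂ ∈ Q.side 2,
      𝔉.RevPt Q δ η z₀ z₂ ∨ ∃ s t, 𝔉.StartAt d₀ Q δ η z₀ s ∧
        ReflTransGen (fun a b => 𝔉.Gst d₀ Q δ η a b ∨ 𝔉.PortBit d₀ h₀ η a b) s t ∧ 𝔉.EndAt d₀ Q δ η t z₂) ↔
      Q ∈ z2QuadConfig D δ η := by
  symm
  rw [mem_z2QuadConfig_iff_sideChain h₀ hδ hcons hX hhubη hhubQ hside0 hside2 hacc]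
  have bitHub : ∀ {i : ι} {a b : ℕ}, (𝔉.𝒯 i).Bit (d₀ i) η a b →
      (𝔉.𝒯 i).hubContact (d₀ i) a ∧ (𝔉.𝒯 i).hubContact (d₀ i) b := by
    rintro i a b ⟨x, k, x', k', ⟨hσ, hβ, -, hcpt⟩, ⟨hσ', hβ', -, hcpt'⟩, -⟩
    exact ⟨((𝔉.𝒯 i).hubContact_of_docking (h₀ i) (mem_O_of_dock hσ hβ) hβ hcpt).2.1,
      ((𝔉.𝒯 i).hubContact_of_docking (h₀ i) (mem_O_of_dock hσ' hβ') hβ' hcpt').2.1⟩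
  have fwd : ∀ {s t : Side ι}, (𝔉.Gst d₀ Q δ η s t ∨ 𝔉.Bit d₀ η s t) →
      ReflTransGen (fun a b => 𝔉.Gst d₀ Q δ η a b ∨ 𝔉.PortBit d₀ h₀ η a b) s t := by
    rintro ⟨i, a⟩ ⟨j, b⟩ (h | ⟨hij, h⟩)
    · exact ReflTransGen.single (Or.inl h)
    · simp only at hij h
      subst hij
      obtain ⟨ha, hb⟩ := bitHub h
      by_cases hsame : (𝔉.𝒯 i).SamePort (d₀ i) (h₀ i) a b
      · exact ReflTransGen.single (Or.inl (gst_of_samePortW h₀ hT hfar hhubη hhubQ ha hb hsame))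
      · exact ReflTransGen.single (Or.inr ⟨rfl, ha, hb, hsame, a, b, samePort_refl (h₀ i) ha, samePort_refl (h₀ i) hb, h⟩)
  have bwd : ∀ {s t : Side ι}, (𝔉.Gst d₀ Q δ η s t ∨ 𝔉.PortBit d₀ h₀ η s t) →
      ReflTransGen (fun a b => 𝔉.Gst d₀ Q δ η a b ∨ 𝔉.Bit d₀ η a b) s t := by
    rintro ⟨i, a⟩ ⟨j, b⟩ (h | ⟨hij, h⟩)
    · exact ReflTransGen.single (Or.inl h)
    · simp only at hij h
      subst hij
      obtain ⟨ha, hb, -, a', b', haa', hbb', hbit⟩ := h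
      obtain ⟨ha', hb'⟩ := bitHub hbit
      have s1 : ReflTransGen (fun a b => 𝔉.Gst d₀ Q δ η a b ∨ 𝔉.Bit d₀ η a b) (i, a) (i, a') :=
        ReflTransGen.single (Or.inl (gst_of_samePortW h₀ hT hfar hhubη hhubQ ha ha' haa'))
      have s2 : ReflTransGen (fun a b => 𝔉.Gst d₀ Q δ η a b ∨ 𝔉.Bit d₀ η a b) (i, a) (i, b') :=
        s1.tail (Or.inr ⟨rfl, hbit⟩)
      exact s2.tail (Or.inl (gst_of_samePortW h₀ hT hfar hhubη hhubQ hb' hb hbb'.symm))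
  have lift : ∀ {r r' : Side ι → Side ι → Prop}, (∀ {a b}, r a b → ReflTransGen r' a b) →
      ∀ {a b}, ReflTransGen r a b → ReflTransGen r' a b := by
    intro r r' h a b hab
    induction hab with
    | refl => exact ReflTransGen.refl
    | tail _ hs ih => exact ih.trans (h hs)
  constructor
  · rintro ⟨z₀, hz₀, z₂, hz₂, h⟩
    refine ⟨z₀, hz₀, z₂, hz₂, h.imp id ?_⟩
    rintro ⟨s, t, hs, hc, he⟩
    exact ⟨s, t, hs, lift fwd hc, he⟩
  · rintro ⟨z₀, hz₀, z₂, hz₂, h⟩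
    refine ⟨z₀, hz₀, z₂, hz₂, h.imp id ?_⟩
    rintro ⟨s, t, hs, hc, he⟩
    exact ⟨s, t, hs, lift bwd hc, he⟩

end PortsW

end TileFamily

end CellComplex

end Literature.Probability.Percolation

end
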